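import Literature.Topology.FourManifolds.DehnSurgeryTwistProofs
import Literature.Topology.FourManifolds.DehnSurgeryFramingUniqueness
import Literature.Topology.FourManifolds.GluckTwistFibre
import Mathlib.AlgebraicTopology.FundamentalGroupoid.SimplyConnected
import Mathlib.Analysis.Convex.Contractible
import HarnessLib

/-!
# The degree of a fibre rotation relating two tubular neighbourhoods is the difference of framings

Topic `Literature/Topology/FourManifolds`; step (S2) of the proof of the named fact
`Literature.Topology.FourManifolds.FramedLink.IsSurgery.nonempty_diffeomorph` (`KirbyMovesSurgery.lean`:
uniqueness of Dehn surgery on a framed link, leaf (U) of Kirby's theorem). Everything here is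
proved; the file declares theorems only.

**Theorem** (`Literature.Topology.FourManifolds.Knot.TubularNbhd.HasFraming.eq_sub_of_rotate`).
Let `ν`, `ν'` be oriented tubular neighbourhoods of the smooth knot `K ⊆ S³` with framing
integers `m`, `m'` (`Knot.TubularNbhd.HasFraming`, `DehnSurgery.lean`), and let `g : S³ → S³` be a
continuous map carrying the knot complement into itself which, on the tube of radius `½` of `ν`,
is `ν'` after the fibre rotation through `d` times the base angle:
`g (ν (e^{iθ}, w)) = ν' (e^{iθ}, R(dθ) w)` (`‖w‖ ≤ ½`, `d ∈ ℤ`). Then `m' = m - d`.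

Indeed `g` maps the meridian of `ν` onto the meridian of `ν'` and the longitude of `ν` onto
the `(1, d)`-curve `f ∘ (ω, ω_d)` of the torus of radius `½` of `ν'` (`f` the torus map
`Knot.TubularNbhd.torusMap` of `DehnSurgeryTwistProofs.lean`, `ω` the standard loop of `S¹`,
`ω_d (t) = e^{2πidt}`); in `π₁(S¹ × S¹)` one has `[(ω, ω_d)] = [(pt, ω)]^d · [(ω, pt)]` (Hatcher,
*Algebraic Topology* (2002), Prop. 1.12 and Thm. 1.7), so in `π₁(S³ ∖ K)ᵃᵇ` the relation
`[λ] = m [μ]` of `ν` is carried by `g_*` to `[λ'] + d [μ'] = m [μ']`, while `[λ'] = m' [μ']`; the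
meridian having infinite order in `π₁(S³ ∖ K)ᵃᵇ` (`zpow_abelianization_meridian_injective`,
`DehnSurgeryFramingUniqueness.lean`, Crowell–Fox VIII (1.2)) gives `m' + d = m`. This is the
classical statement that the framings of a knot form a `ℤ`-torsor under the twists of the normal
bundle (Rolfsen, *Knots and Links* (1976), §9.F; Gompf–Stipsicz, *4-Manifolds and Kirby
Calculus* (1999), §4.5), in the form consumed by the uniqueness of surgery: two tubular
neighbourhoods with the *same* framing that are conjugate up to a rotation field of degree `d`
have `d = 0`.

* `Literature.Topology.FourManifolds.Knot.TubularNbhd.homotopic_of_circlePoint_lifts` — two loops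
  of `S¹` with lifts to `ℝ` ending at the same point are homotopic (`ℝ` is simply connected);
* `Literature.Topology.FourManifolds.Knot.TubularNbhd.fromPath_eq_zpow_of_eq_circlePoint` — the
  loop `t ↦ e^{2πidt}` represents `[ω]^d` (Hatcher (2002), Thm. 1.7);
* `Literature.Topology.FourManifolds.Knot.TubularNbhd.fromPath_circleLoop_prod_eq` — the torus
  identity for general `d` (the tree's `fromPath_circleLoop_prod_circleLoopσ` is `d = ±1`);
* `Literature.Topology.FourManifolds.Knot.TubularNbhd.HasFraming.eq_sub_of_rotate` — the theorem.

## References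

* D. Rolfsen, *Knots and Links*, Publish or Perish (1976), §9.F. [cite: Rolfsen1976, §9.F]
* R. E. Gompf, A. I. Stipsicz, *4-Manifolds and Kirby Calculus*, GSM 20 (1999), §4.5.
  [cite: GompfStipsicz1999, §4.5]
* A. Hatcher, *Algebraic Topology*, CUP (2002), Prop. 1.12, Thm. 1.7. [cite: HatcherAT2002, Prop. 1.12]
* R. H. Crowell, R. H. Fox, *Introduction to Knot Theory* (1963), Ch. VIII (1.2).
  [cite: CrowellFox1963, Ch. VIII (1.2)]

## Design notes

* The loop algebra follows `DehnSurgeryTwistProofs.lean` (`circleLoop`, `fromPath_mk_prod`,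
  transport by Mathlib's `FundamentalGroup.mapOfEq` and the tree's
  `FundamentalGroup.mapOfEq_fromPath_eq`). Loops of degree `d` and affine paths of `ℝ` are
  provided by existence theorems (`exists_loop_eq_circlePoint`, `exists_path_eq_line`) rather than
  definitions, so that the file stays a pure proof file.
* The map `g` is only assumed continuous and to preserve the knot complement; downstream it is a
  diffeomorphism of `S³` fixing `K` pointwise.
* No declaration in this file uses `sorry`.
-/

noncomputable section

open Set Function
open scoped Manifold ContDiff Topology

namespace Literature.Topology.FourManifolds

namespace Knot.TubularNbhd

/-! ### Loops of the circle of degree `d` -/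

section CircleLoops

/-- `circlePoint` is invariant under integer multiples of `2π`. [folklore] -/
theorem circlePoint_add_int_mul_two_pi (θ : ℝ) (d : ℤ) :
    circlePoint (θ + d * (2 * Real.pi)) = circlePoint θ :=
  (periodic_circlePoint.int_mul d) θ

/-- `circlePoint (2πd) = circlePoint 0` for an integer `d`. [folklore] -/
theorem circlePoint_int_mul_two_pi (d : ℤ) : circlePoint (d * (2 * Real.pi)) = circlePoint 0 := by
  simpa only [zero_add] using circlePoint_add_int_mul_two_pi 0 d

/-- **The loop of degree `d`** of the circle exists as a path: `t ↦ circlePoint (2πdt)`, based at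
`circlePoint 0` (the standard loop `circleLoop` for `d = 1`). [folklore] -/
theorem exists_loop_eq_circlePoint (d : ℤ) : ∃ γ : Path (circlePoint 0) (circlePoint 0),
    ∀ t, γ t = circlePoint (d * (2 * Real.pi * t)) :=
  ⟨{ toFun := fun t ↦ circlePoint (d * (2 * Real.pi * t)),
     continuous_toFun := by fun_prop,
     source' := by simp only [Set.Icc.coe_zero, mul_zero],
     target' := by simp only [Set.Icc.coe_one, mul_one, circlePoint_int_mul_two_pi] },
    fun _ ↦ rfl⟩

/-- **The affine path** `t ↦ a + (b - a) t` of `ℝ` from `a` to `b` exists as a path. [folklore] -/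
theorem exists_path_eq_line (a b : ℝ) : ∃ p : Path a b, ∀ t, p t = a + (b - a) * t :=
  ⟨{ toFun := fun t ↦ a + (b - a) * t,
     continuous_toFun := by fun_prop,
     source' := by simp,
     target' := by simp }, fun _ ↦ rfl⟩

/-- **Loops of the circle with lifts ending at the same point are homotopic**: if
`γ₁ = circlePoint ∘ p₁` and `γ₂ = circlePoint ∘ p₂` for paths `p₁`, `p₂` in `ℝ` from `0` to the
same `c`, then `γ₁ ≃ γ₂` (`p₁ ≃ p₂` rel endpoints as `ℝ` is simply connected; Hatcher (2002),
proof of Thm. 1.7). [cite: HatcherAT2002, Thm. 1.7] -/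
theorem homotopic_of_circlePoint_lifts {c : ℝ} (γ₁ γ₂ : Path (circlePoint 0) (circlePoint 0))
    (p₁ p₂ : Path (0 : ℝ) c) (h₁ : ∀ t, γ₁ t = circlePoint (p₁ t))
    (h₂ : ∀ t, γ₂ t = circlePoint (p₂ t)) : γ₁.Homotopic γ₂ := by
  have hc : circlePoint 0 = circlePoint c := by
    have := h₁ 1
    rwa [γ₁.target, p₁.target] at this
  let f : C(ℝ, Metric.sphere (0 : EuclideanSpace ℝ (Fin 2)) 1) :=
    ⟨circlePoint, continuous_circlePoint⟩
  have e₁ : γ₁ = (p₁.map f.continuous).cast rfl hc := Path.ext (funext fun t ↦ h₁ t)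
  have e₂ : γ₂ = (p₂.map f.continuous).cast rfl hc := Path.ext (funext fun t ↦ h₂ t)
  rw [e₁, e₂]
  exact ((SimplyConnectedSpace.paths_homotopic p₁ p₂).map f).pathCast rfl hc

/-- A concatenation of lifted paths is lifted by the concatenation of the lifts. [folklore] -/
theorem trans_apply_eq_of_lifts {X Y : Type*} [TopologicalSpace X] [TopologicalSpace Y]
    (f : X → Y) {a b c : X} {a' b' c' : Y} (p : Path a b) (q : Path b c) (γ : Path a' b')
    (δ : Path b' c') (hγ : ∀ t, γ t = f (p t)) (hδ : ∀ t, δ t = f (q t)) (t : unitInterval) :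
    (γ.trans δ) t = f ((p.trans q) t) := by
  rw [Path.trans_apply, Path.trans_apply]
  split_ifs <;> simp only [hγ, hδ]

/-- **The loop of degree `n ≥ 0` represents `[ω]^n`** in `π₁(S¹, 1)` (induction on `n`:
`ω_{n+1} ≃ ω · ω_n` by comparison of lifts). Hatcher (2002), Thm. 1.7. [cite: HatcherAT2002, Thm. 1.7] -/
theorem fromPath_eq_pow_of_eq_circlePoint (n : ℕ) (γ : Path (circlePoint 0) (circlePoint 0))
    (hγ : ∀ t, γ t = circlePoint (n * (2 * Real.pi * t))) :
    FundamentalGroup.fromPath (Path.Homotopic.Quotient.mk γ) =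
      FundamentalGroup.fromPath (Path.Homotopic.Quotient.mk circleLoop) ^ n := by
  induction n generalizing γ with
  | zero =>
    have e : γ = Path.refl (circlePoint 0) :=
      Path.ext (funext fun t ↦ by rw [hγ t, Nat.cast_zero, zero_mul, Path.refl_apply])
    rw [pow_zero, e]
    rfl
  | succ n ih =>
    obtain ⟨γn, hγn⟩ := exists_loop_eq_circlePoint n
    have ihn := ih γn fun t ↦ by rw [hγn t, Int.cast_natCast]
    rw [pow_succ, ← ihn, FundamentalGroup.mul_def, ← Path.Homotopic.Quotient.mk_trans]
    refine Path.Homotopic.Quotient.eq.2 ?_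
    -- lifts: `2π(n+1)t` for `γ`, the two-piece affine path for `ω · ω_n`
    obtain ⟨ℓ, hℓ⟩ := exists_path_eq_line 0 ((n + 1 : ℕ) * (2 * Real.pi))
    obtain ⟨ℓ₁, hℓ₁⟩ := exists_path_eq_line 0 (2 * Real.pi)
    obtain ⟨ℓ₂, hℓ₂⟩ := exists_path_eq_line (2 * Real.pi) ((n + 1 : ℕ) * (2 * Real.pi))
    refine homotopic_of_circlePoint_lifts _ _ ℓ (ℓ₁.trans ℓ₂) (fun t ↦ ?_)
      (trans_apply_eq_of_lifts circlePoint _ _ _ _ (fun t ↦ ?_) (fun t ↦ ?_))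
    · rw [hγ, hℓ]
      congr 1
      push_cast
      ring
    · rw [circleLoop_apply, hℓ₁]
      congr 1
      ring
    · rw [hγn, hℓ₂, show 2 * Real.pi + (((n + 1 : ℕ) : ℝ) * (2 * Real.pi) - 2 * Real.pi) * t =
        (n : ℤ) * (2 * Real.pi * t) + 2 * Real.pi by push_cast; ring, circlePoint_add_two_pi]

/-- **The loop of degree `d ∈ ℤ` represents `[ω]^d`** in `π₁(S¹, 1)` (negative degrees by
reversal of the loop). Hatcher (2002), Thm. 1.7. [cite: HatcherAT2002, Thm. 1.7] -/
theorem fromPath_eq_zpow_of_eq_circlePoint (d : ℤ) (γ : Path (circlePoint 0) (circlePoint 0))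
    (hγ : ∀ t, γ t = circlePoint (d * (2 * Real.pi * t))) :
    FundamentalGroup.fromPath (Path.Homotopic.Quotient.mk γ) =
      FundamentalGroup.fromPath (Path.Homotopic.Quotient.mk circleLoop) ^ d := by
  obtain ⟨n, rfl | rfl⟩ := Int.eq_nat_or_neg d
  · rw [zpow_natCast]
    exact fromPath_eq_pow_of_eq_circlePoint n γ fun t ↦ by rw [hγ t, Int.cast_natCast]
  · -- the reversed loop has degree `n`
    have hsymm : ∀ t, γ.symm t = circlePoint (n * (2 * Real.pi * t)) := fun t ↦ by
      change γ (unitInterval.symm t) = _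
      rw [hγ, unitInterval.coe_symm_eq, Int.cast_neg, Int.cast_natCast,
        show -(n : ℝ) * (2 * Real.pi * (1 - t)) = n * (2 * Real.pi * t) + (-(n : ℤ) : ℤ) *
          (2 * Real.pi) by push_cast; ring, circlePoint_add_int_mul_two_pi]
    have h := fromPath_eq_pow_of_eq_circlePoint n γ.symm hsymm
    have e : FundamentalGroup.fromPath (Path.Homotopic.Quotient.mk γ.symm) =
        (FundamentalGroup.fromPath (Path.Homotopic.Quotient.mk γ))⁻¹ := rfl
    rw [e] at h
    rw [zpow_neg, zpow_natCast, ← h, inv_inv]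

/-- In `π₁(X × S¹)` the class of `(pt, ω_d)` is `[(pt, ω)]^d`. [folklore] -/
theorem fromPath_refl_prod_eq_zpow {X : Type*} [TopologicalSpace X] (x : X) (d : ℤ)
    (γ : Path (circlePoint 0) (circlePoint 0))
    (hγ : ∀ t, γ t = circlePoint (d * (2 * Real.pi * t))) :
    FundamentalGroup.fromPath (Path.Homotopic.Quotient.mk ((Path.refl x).prod γ)) =
      FundamentalGroup.fromPath (Path.Homotopic.Quotient.mk
        ((Path.refl x).prod circleLoop)) ^ d := by
  let inr : C(Metric.sphere (0 : EuclideanSpace ℝ (Fin 2)) 1,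
      X × Metric.sphere (0 : EuclideanSpace ℝ (Fin 2)) 1) := ⟨fun y ↦ (x, y), by fun_prop⟩
  have h1 := FundamentalGroup.mapOfEq_fromPath_eq inr
    (rfl : inr (circlePoint 0) = (x, circlePoint 0)) γ ((Path.refl x).prod γ) fun _ ↦ rfl
  have h2 := FundamentalGroup.mapOfEq_fromPath_eq inr
    (rfl : inr (circlePoint 0) = (x, circlePoint 0)) circleLoop ((Path.refl x).prod circleLoop)
    fun _ ↦ rfl
  rw [← h1, ← h2, ← map_zpow, fromPath_eq_zpow_of_eq_circlePoint d γ hγ]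

/-- **The torus identity for the `(1, d)`-curve**: in `π₁(S¹ × S¹)` the class of `(ω, ω_d)` is
`[(pt, ω)]^d * [(ω, pt)]` (Hatcher (2002), Prop. 1.12 with Thm. 1.7; the case `d = ±1` is the
tree's `fromPath_circleLoop_prod_circleLoopσ`). [cite: HatcherAT2002, Prop. 1.12] -/
theorem fromPath_circleLoop_prod_eq (d : ℤ) (γ : Path (circlePoint 0) (circlePoint 0))
    (hγ : ∀ t, γ t = circlePoint (d * (2 * Real.pi * t))) :
    FundamentalGroup.fromPath (Path.Homotopic.Quotient.mk (circleLoop.prod γ)) =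
      FundamentalGroup.fromPath (Path.Homotopic.Quotient.mk
          ((Path.refl (circlePoint 0)).prod circleLoop)) ^ d *
        FundamentalGroup.fromPath (Path.Homotopic.Quotient.mk
          (circleLoop.prod (Path.refl (circlePoint 0)))) := by
  rw [fromPath_mk_prod, fromPath_refl_prod_eq_zpow _ d γ hγ]

end CircleLoops

/-! ### Rotations of the framing base vector -/

section Rot

/-- A rotation takes `circlePoint 0 = (1, 0)` to `circlePoint s`. [folklore] -/
theorem rotPlane_coe_circlePoint_zero (s : ℝ) :
    rotPlane s ((circlePoint 0 : Metric.sphere (0 : EuclideanSpace ℝ (Fin 2)) 1) :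
      EuclideanSpace ℝ (Fin 2)) = ((circlePoint s : Metric.sphere (0 : EuclideanSpace ℝ (Fin 2)) 1) :
        EuclideanSpace ℝ (Fin 2)) := by
  ext i
  fin_cases i <;> simp

/-- A rotation of the framing base vector `e₀ = ½ (1, 0)`: `R(s) e₀ = ½ circlePoint s`.
[folklore] -/
theorem rotPlane_framingBaseVector (s : ℝ) :
    rotPlane s framingBaseVector = (1 / 2 : ℝ) •
      ((circlePoint s : Metric.sphere (0 : EuclideanSpace ℝ (Fin 2)) 1) : EuclideanSpace ℝ (Fin 2)) := by
  rw [framingBaseVector, rotPlane_smul, rotPlane_coe_circlePoint_zero]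

/-- Half a unit vector has norm `½`. [folklore] -/
theorem norm_half_smul_coe_sphere (u : Metric.sphere (0 : EuclideanSpace ℝ (Fin 2)) 1) :
    ‖(1 / 2 : ℝ) • (u : EuclideanSpace ℝ (Fin 2))‖ = 1 / 2 := by
  rw [norm_smul, norm_eq_of_mem_sphere, mul_one, Real.norm_of_nonneg]
  norm_num

end Rot

/-! ### The degree of the rotation field is the difference of framings -/

section Degree

variable {K : Knot}

/-- **The degree of a fibre rotation relating two tubular neighbourhoods is the difference of
their framings.** Let `ν`, `ν'` be oriented tubular neighbourhoods of the knot `K` with framings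
`m`, `m'`, and let `g : S³ → S³` be continuous, carry `S³ ∖ K` into itself and satisfy
`g (ν (circlePoint θ, w)) = ν' (circlePoint θ, R(dθ) w)` for `‖w‖ ≤ ½` (on the tube of radius
`½`, `g ∘ ν` is `ν'` composed with the rotation of the fibre over `e^{iθ}` through `dθ`, `d ∈ ℤ`).
Then `m' = m - d`: `g` maps the meridian of `ν` to the meridian of `ν'` and the longitude of `ν`
to the `(1, d)`-curve of the torus of `ν'`, whose class in `π₁(S³ ∖ K)ᵃᵇ` is `[λ'] + d [μ']`
(`fromPath_circleLoop_prod_eq` pushed forward by the torus map), so `g_*` turns `[λ] = m [μ]`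
into `(m' + d) [μ'] = m [μ']`, and the meridian has infinite order
(`zpow_abelianization_meridian_injective`). In particular two tubular neighbourhoods with the same
framing are conjugate only up to rotation fields of degree `0`. Rolfsen (1976), §9.F;
Gompf–Stipsicz (1999), §4.5 (framings of a knot in `S³` form a `ℤ`-torsor under the twists of the
normal bundle). [cite: GompfStipsicz1999, §4.5] -/
theorem HasFraming.eq_sub_of_rotate {ν ν' : Knot.TubularNbhd K} {m m' : ℤ} (h : ν.HasFraming m)
    (h' : ν'.HasFraming m') {g : Metric.sphere (0 : EuclideanSpace ℝ (Fin 4)) 1 →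
      Metric.sphere (0 : EuclideanSpace ℝ (Fin 4)) 1} (hg : Continuous g)
    (hgK : MapsTo g (range K)ᶜ (range K)ᶜ) (d : ℤ)
    (hrel : ∀ (θ : ℝ) (w : EuclideanSpace ℝ (Fin 2)), ‖w‖ ≤ 1 / 2 →
      g (ν (circlePoint θ, w)) = ν' (circlePoint θ, rotPlane (d * θ) w)) :
    m' = m - d := by
  -- the induced self-map of the knot complement and the base points
  let G : C(K.complement, K.complement) :=
    ⟨fun a ↦ ⟨g a, hgK a.2⟩, (hg.comp continuous_subtype_val).subtype_mk _⟩
  have hGapply : ∀ a : K.complement, (G a : Metric.sphere (0 : EuclideanSpace ℝ (Fin 4)) 1) = g a :=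
    fun _ ↦ rfl
  have hrel0 : ∀ w : EuclideanSpace ℝ (Fin 2), ‖w‖ ≤ 1 / 2 →
      g (ν (circlePoint 0, w)) = ν' (circlePoint 0, w) := fun w hw ↦ by
    rw [hrel 0 w hw, mul_zero, rotPlane_zero]
  have hfb : ‖framingBaseVector‖ ≤ 1 / 2 := by
    rw [framingBaseVector, norm_half_smul_coe_sphere]
  have hGb : G ν.basePoint = ν'.basePoint := by
    apply Subtype.ext
    rw [hGapply, coe_basePoint, coe_basePoint, hrel0 _ hfb]
  -- loops of the torus `S¹ × S¹` and the `(1, d)`-curve of `ν'`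
  obtain ⟨γd, hγd⟩ := exists_loop_eq_circlePoint d
  have hft : ν'.torusMap (circlePoint 0, circlePoint 0) = ν'.basePoint := ν'.torusMap_base
  let δ' : Path ν'.basePoint ν'.basePoint :=
    ((circleLoop.prod γd).map ν'.torusMap.continuous).cast hft.symm hft.symm
  have hδ' : ∀ t, (δ' t : Metric.sphere (0 : EuclideanSpace ℝ (Fin 4)) 1) =
      ν' (circlePoint (2 * Real.pi * t), (1 / 2 : ℝ) •
        ((circlePoint (d * (2 * Real.pi * t)) : Metric.sphere (0 : EuclideanSpace ℝ (Fin 2)) 1) :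
          EuclideanSpace ℝ (Fin 2))) := fun t ↦ by
    rw [← hγd t]
    rfl
  -- transport along `G`, from `ν.basePoint` to `ν'.basePoint`
  let ι := FundamentalGroup.mapOfEq G hGb
  have eιM : ι (FundamentalGroup.fromPath (Path.Homotopic.Quotient.mk ν.meridian)) =
      FundamentalGroup.fromPath (Path.Homotopic.Quotient.mk ν'.meridian) :=
    FundamentalGroup.mapOfEq_fromPath_eq G hGb _ _ fun t ↦ by
      apply Subtype.ext
      rw [hGapply, coe_meridian_apply, coe_meridian_apply,
        hrel0 _ (norm_half_smul_coe_sphere _).le]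
  have eιL : ι (FundamentalGroup.fromPath (Path.Homotopic.Quotient.mk ν.longitude)) =
      FundamentalGroup.fromPath (Path.Homotopic.Quotient.mk δ') :=
    FundamentalGroup.mapOfEq_fromPath_eq G hGb _ _ fun t ↦ by
      apply Subtype.ext
      rw [hGapply, coe_longitude_apply, hδ', hrel _ _ hfb,
        rotPlane_framingBaseVector]
  -- transport along the torus map of `ν'`
  let gT := FundamentalGroup.mapOfEq ν'.torusMap hft
  have egα : gT (FundamentalGroup.fromPath (Path.Homotopic.Quotient.mk
      (circleLoop.prod (Path.refl (circlePoint 0))))) =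
        FundamentalGroup.fromPath (Path.Homotopic.Quotient.mk ν'.longitude) :=
    FundamentalGroup.mapOfEq_fromPath_eq ν'.torusMap hft _ _ fun t ↦ rfl
  have egβ : gT (FundamentalGroup.fromPath (Path.Homotopic.Quotient.mk
      ((Path.refl (circlePoint 0)).prod circleLoop))) =
        FundamentalGroup.fromPath (Path.Homotopic.Quotient.mk ν'.meridian) :=
    FundamentalGroup.mapOfEq_fromPath_eq ν'.torusMap hft _ _ fun t ↦ rfl
  have egδ : gT (FundamentalGroup.fromPath (Path.Homotopic.Quotient.mk (circleLoop.prod γd))) =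
      FundamentalGroup.fromPath (Path.Homotopic.Quotient.mk δ') :=
    FundamentalGroup.mapOfEq_fromPath_eq ν'.torusMap hft _ _ fun t ↦ rfl
  -- the torus identity `[(ω, ω_d)] = [(pt, ω)]^d * [(ω, pt)]`, pushed forward to `ν'.basePoint`
  have key := congrArg gT (fromPath_circleLoop_prod_eq d γd hγd)
  rw [map_mul, map_zpow, egδ, egβ, egα] at key
  -- the framing relation of `ν`, pushed forward along `G`
  have h0 : Abelianization.of (FundamentalGroup.fromPath
      (Path.Homotopic.Quotient.mk ν.longitude)) = Abelianization.of
        (FundamentalGroup.fromPath (Path.Homotopic.Quotient.mk ν.meridian)) ^ m := h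
  have h1 := congrArg (Abelianization.map ι) h0
  rw [map_zpow, Abelianization.map_of, Abelianization.map_of, eιL, eιM, key, map_mul,
    map_zpow] at h1
  -- `[μ']^d * [μ']^m' = [μ']^m`
  have h2 : Abelianization.of (FundamentalGroup.fromPath
      (Path.Homotopic.Quotient.mk ν'.longitude)) = Abelianization.of
        (FundamentalGroup.fromPath (Path.Homotopic.Quotient.mk ν'.meridian)) ^ m' := h'
  rw [h2, ← zpow_add] at h1
  have h3 := ν'.zpow_abelianization_meridian_injective h1
  omega

end Degree

end Knot.TubularNbhd

end Literature.Topology.FourManifolds
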